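import Summits.Ventures.PercRepro.ProfileGapMonoColoopBandSucc

/-!
# PercRepro — THE AVERAGED DELETION STEP OF THE THRESHOLD FAMILY, AND THE ROW `(q−1, q)` FROM IT
(p5, gen 23; `proofs/P5-GM1.md` §21(e)/(h); announced INBOX 11462)

`AvgStepT α q t` is the averaged deletion step `Σ_{z ∈ E} Φ_t(N ∖ z) ≤ (#E − q) · Φ_t(N)` of the threshold gap
`Φ_t(N) = q · #{S : ρ(S) = q, ρ(E∖S) ≥ t} − thresholdSum N q t`, for every finite matroid on `≥ t + q + 1` elements
(written without subtraction).  It is a CONJECTURE, NOT asserted here: exhaustively true on every matroid on `≤ 9`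
elements at `t = q − 1` and `t = q` (0 failures on 1,538,862 / 1,537,447 instances, two implementations) and false
at `t ≥ q + 1`.  With the induction `thresholdIneq_of_avgStepT` (strong induction on `#E`) and the free base at
`t = q − 1` (`thresholdIneq_of_card_le`, the tree's `profileIneqMinusQ_of_card_le` through `thresholdIneq_iff_row`)
it gives the row `(q − 1, q)` of the profile on every finite matroid (`profileIneqMinusQ_succ_of_avgStepT`,
`profileIneq_succ_of_avgStepT`) — the first off-diagonal level of every co-rank, from the averaged step alone.

* `AvgStepT` (conjecture def), `thresholdIneq_of_avgStep_step`, **`thresholdIneq_of_avgStepT`**,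
  `thresholdIneq_of_card_le`, **`profileIneqMinusQ_succ_of_avgStepT`**, `profileIneq_succ_of_avgStepT`.
-/

open scoped Matroid

namespace PercRepro.Cogirth

open Finset ThmH Skew Shadow Profile

variable {α : Type} [DecidableEq α] {M : Matroid α} [M.Finite]

section AvgStep

variable {q t : ℕ}

/-- **The averaged deletion step of the threshold gap** (a CONJECTURE at `t ≤ q`, NOT asserted):
`Σ_{z ∈ E} Φ_t(N ∖ z) ≤ (#E − q) · Φ_t(N)` for every finite matroid with `#E ≥ t + q + 1`, written without subtraction. -/
def AvgStepT (α : Type) [DecidableEq α] (q t : ℕ) : Prop :=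
  ∀ (N : Matroid α) [N.Finite], t + q + 1 ≤ (gr N).card →
    ∑ z ∈ gr N, q * (levelSetCoQ (N ＼ ({z} : Set α)) t q).card + ((gr N).card - q) * thresholdSum N q t ≤
      ((gr N).card - q) * (q * (levelSetCoQ N t q).card) + ∑ z ∈ gr N, thresholdSum (N ＼ ({z} : Set α)) q t

/-- **The induction step**: if `(I_t)` holds for every single-element deletion of `N` and the averaged step holds at
`N` with `q < #E`, then `(I_t)` holds for `N`. -/
theorem thresholdIneq_of_avgStep_step {N : Matroid α} [N.Finite] (hn : q < (gr N).card)
    (hav : ∑ z ∈ gr N, q * (levelSetCoQ (N ＼ ({z} : Set α)) t q).card +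
        ((gr N).card - q) * thresholdSum N q t ≤
      ((gr N).card - q) * (q * (levelSetCoQ N t q).card) +
        ∑ z ∈ gr N, thresholdSum (N ＼ ({z} : Set α)) q t)
    (hdel : ∀ z ∈ gr N, ThresholdIneq (N ＼ ({z} : Set α)) q t) : ThresholdIneq N q t := by
  unfold ThresholdIneq
  have hsum : ∑ z ∈ gr N, thresholdSum (N ＼ ({z} : Set α)) q t ≤
      ∑ z ∈ gr N, q * (levelSetCoQ (N ＼ ({z} : Set α)) t q).card :=
    sum_le_sum (fun z hz => hdel z hz)
  have h1 : ∑ z ∈ gr N, q * (levelSetCoQ (N ＼ ({z} : Set α)) t q).card +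
      ((gr N).card - q) * thresholdSum N q t ≤
      ∑ z ∈ gr N, q * (levelSetCoQ (N ＼ ({z} : Set α)) t q).card +
        ((gr N).card - q) * (q * (levelSetCoQ N t q).card) := by
    calc _ ≤ ((gr N).card - q) * (q * (levelSetCoQ N t q).card) +
          ∑ z ∈ gr N, thresholdSum (N ＼ ({z} : Set α)) q t := hav
      _ ≤ ((gr N).card - q) * (q * (levelSetCoQ N t q).card) +
          ∑ z ∈ gr N, q * (levelSetCoQ (N ＼ ({z} : Set α)) t q).card := Nat.add_le_add_left hsum _
      _ = _ := Nat.add_comm _ _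
  have h2 : ((gr N).card - q) * thresholdSum N q t ≤
      ((gr N).card - q) * (q * (levelSetCoQ N t q).card) := Nat.le_of_add_le_add_left h1
  exact Nat.le_of_mul_le_mul_left h2 (by omega)

/-- **`(I_t)` on every finite matroid from the averaged step and the base `#E ≤ t + q`**: strong induction on `#E`. -/
theorem thresholdIneq_of_avgStepT (h : AvgStepT α q t)
    (hbase : ∀ (N : Matroid α) [N.Finite], (gr N).card ≤ t + q → ThresholdIneq N q t)
    (M : Matroid α) [M.Finite] : ThresholdIneq M q t := by
  suffices hh : ∀ n : ℕ, ∀ (N : Matroid α) [N.Finite], (gr N).card = n → ThresholdIneq N q t from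
    hh _ M rfl
  intro n
  induction n using Nat.strong_induction_on with
  | _ n ih =>
  intro N _ hN
  rcases Nat.lt_or_ge (gr N).card (t + q + 1) with hsmall | hbig
  · exact hbase N (by omega)
  · refine thresholdIneq_of_avgStep_step (by omega) (h N hbig) (fun z hz => ?_)
    have hlt : ((gr N).erase z).card < n := by rw [← hN]; exact card_erase_lt_of_mem hz
    exact ih _ hlt (N ＼ ({z} : Set α)) (by rw [gr_delete'])

end AvgStep

section RowSucc

variable {q : ℕ}

/-- **The free base of the row `(q − 1, q)`** (`1 ≤ q`): on `#E ≤ 2q − 1` elements every rank-`(q−1)` set with a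
complement of rank `≥ q` has an independent complement of size exactly `q`, which is a co-rank-`(q−1)` rank-`q` set —
the tree's `profileIneqMinusQ_of_card_le`. -/
theorem thresholdIneq_of_card_le {N : Matroid α} [N.Finite] (hq : 1 ≤ q) (hn : (gr N).card ≤ 2 * q - 1) :
    ThresholdIneq N q (q - 1) :=
  (thresholdIneq_iff_row hq).2 (profileIneqMinusQ_of_card_le (by omega) (by omega))

/-- **The row `(q − 1, q)` on every finite matroid from the averaged step at `t = q − 1`** (`1 ≤ q`): the base
`#E ≤ 2q − 1` is free, the induction is `thresholdIneq_of_avgStepT`. -/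
theorem profileIneqMinusQ_succ_of_avgStepT (hq : 1 ≤ q) (h : AvgStepT α q (q - 1)) (M : Matroid α) [M.Finite] :
    ProfileIneqMinusQ M (q - 1) q :=
  (thresholdIneq_iff_row hq).1
    (thresholdIneq_of_avgStepT h (fun N _ hN => thresholdIneq_of_card_le hq (by omega)) M)

/-- **`(Π_{q−1,q})` on every finite matroid from the averaged step at `t = q − 1`** (`1 ≤ q`). -/
theorem profileIneq_succ_of_avgStepT (hq : 1 ≤ q) (h : AvgStepT α q (q - 1)) (M : Matroid α) [M.Finite] :
    ProfileIneq M (q - 1) q :=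
  profileIneq_of_minusQ (by omega) (profileIneqMinusQ_succ_of_avgStepT hq h M)

end RowSucc

end PercRepro.Cogirth
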